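import Literature.NumberTheory.Sieve.HeathBrownCubicPrimes
import HarnessLib

/-!
# Primes `x³ + 2y³` with `(x, y)` in a residue class (Heath-Brown–Moroz 2004, Theorem 2)

Topic `Literature/NumberTheory/Sieve`, sibling of `HeathBrownCubicPrimes.lean` (Heath-Brown's theorem on
primes `x³ + 2y³`, there the named fact `HeathBrown2001_primePairCount_asymptotic`, discharged in
`HeathBrownCubicPrimesHolds.lean`). Source: D. R. Heath-Brown and B. Z. Moroz, *On the representation of
primes by cubic polynomials in two variables*, Proc. London Math. Soc. (3) 88 (2004) 289–312
[HeathBrownMoroz2004] — Theorem 2 (the asymptotic formula (1.2)) for the polynomial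
`f(x⃗) = N_{k/ℚ}(γ + d·x)·N𝔡⁻¹` of (1.1), SPECIALISED here to the case the Parity cell needs:
`k = ℚ(θ)`, `θ³ = 2`, `F = ℤ + ℤθ` (so `f₀ = x³ + 2y³ = N(x + yθ)`), a modulus `d ≥ 1` and a class
representative `γ = a + bθ` with `gcd(a³ + 2b³, d) = 1` ("admissible class"). For such a class
`𝔡 = (γ) + d𝔬 = 𝔬`, so `f(x⃗) = (a + d x₁)³ + 2(b + d x₂)³` exactly, and `ε(f) = 1` (below), and
Theorem 2 reads: with `η = (log X)^{−c}` for a suitable `c > 0`,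

  `#{x⃗ ∈ ℤ² ∩ (X, X(1+η)]² : ((a + dx₁), (b + dx₂)) = 1, (a + dx₁)³ + 2(b + dx₂)³ prime}`
  `= σ₁ · η²X²/(3 log X) · {1 + O((log log X)^{−1/6})}`, `σ₁ = σ₀ · w(d)`,

where `σ₀ = ∏_p (1 − (ν_p − 1)/p)` is Heath-Brown's singular product (`singularProductPartial`,
`HeathBrownCubicPrimes`) and `w(d) = ∏_{p ∣ d} p²(p + 1)/((p² − 1)(p + 1 − ν_p))` (`classWeight`).

## The local factors (how `σ₁(f) = σ₀ · w(d)` is read off the source)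

(3.1), p. 15 of the render: `σ₁(f) = σ(f) ∏_{p ∣ d} (1 − p⁻²)⁻¹`, `σ(f) = ∏_p (1 + 1/p)(1 − Γ(p))`,
with `Γ` the multiplicative density function of Lemma 2.4. Lemma 2.4 (iv): `Γ(p) = ν_p/(p + 1)`
whenever `p ∤ C`, `C = i(θ)N(ω₁ω₂)·d`; here `i(θ) = 1` (`𝔬 = ℤ[θ]`), `N(ω₁ω₂) = N(θ) = 2`, so
`C = 2d`. For `p = 2 ∤ d` the proof of Lemma 2.4 (display after (2.35), p. 14) gives
`Γ(2) = 1 + (1 − 2²)⁻¹ · #{u⃗ mod 2 : (N(u₁ + u₂θ), 2) = 1} = 1 − 2/3 = 1/3 = ν₂/3` as well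
(`u₁³ + 2u₂³` is odd iff `u₁` is), so `Γ_f(p) = ν_p/(p+1)` for EVERY `p ∤ d`, and the last lines of
p. 14 state «`Γ(p)` depends neither on `d`, nor on `γ`, if `p` does not divide `d`». For `p ∣ d`,
(2.36): `1 − Γ(p) = p⁻² #{u⃗ mod p : (A_u(γ), p) = 1}` with `A_u(γ) = (γ + ud)𝔡⁻¹ ≡ γ (mod p𝔬)`;
admissibility (`p ∤ N(γ) = a³ + 2b³`) makes every `u⃗` count, so `Γ_f(p) = 0`. Hence
`σ(f) = σ(f₀) ∏_{p ∣ d} (1 − ν_p/(p+1))⁻¹`, `σ(f₀) = ∏_p (1 + 1/p)(1 − ν_p/(p+1)) = ∏_p (p + 1 − ν_p)/p`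
`= ∏_p (1 − (ν_p − 1)/p) = σ₀` (Heath-Brown 2001, p. 2), and
`σ₁(f) = σ₀ ∏_{p ∣ d} (p+1)/(p+1−ν_p) · p²/(p²−1) = σ₀ · w(d)`. Consistency check (proved below as
`classWeightFactor_mul`): the admissible classes modulo a prime `p ∤ 6` number
`p² − 1 − (p − 1)ν_p = (p − 1)(p + 1 − ν_p)` (the non-zero zeros of `a³ + 2b³ (mod p)` are
`(p − 1)ν_p`), and `w(p) · (p − 1)(p + 1 − ν_p)/p² = 1` — summing the per-class main terms over the
admissible classes modulo `d` returns Heath-Brown's main term for all coprime pairs at height `dX`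
(box side `d·ηX`, i.e. `p²` sub-boxes' worth per prime), as it must since a prime value `> d` lies
in an admissible class automatically. Also `ε(f) = 1`: by Lemma 2.4, `ε(f) ∈ {1,2,3,6}` and for
`p ∈ {2, 3}`, `p ∣ ε(f) ⇔ Γ(p) = 1`; but `Γ(p) ∈ {ν_p/(p+1), 0} ≠ 1`. And the standing
normalisation «h.c.f.(γ₁, γ₂, d) = 1» of §2 holds for admissible classes.

## Statement conventions (as in `HeathBrownCubicPrimes`)

* The count is over PAIRS `x⃗` (multiplicity of representations), as in (3.2) `π(𝒜)` of the source
  and in the tree's `primePairCount`; the printed `π(f, X) = #{p : p = f(a⃗), a⃗ ∈ I(X)}` differs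
  from it by the pairs with a repeated prime value, negligible against the error term (and (3.2) is
  what the paper proves).
* `η = (log X)^{−c}`, «`c` a suitable positive constant defined as in [3, 4]» (p. 2): `∃ c > 0`,
  depending on the class (it is fixed on p. 21 of Heath-Brown 2001 from the Type-II constant);
  the `O`-constant may depend on `d, a, b` (fixed data in the source) — `=O[atTop]` per class.
  QUANTIFIER ORDER, as printed: Theorem 2 is stated AFTER «Let us fix a ℤ-submodule `F` of `𝔬` of
  rank 2, an integer `d` in `ℕ`, and a vector `γ⃗` in `ℤ²`» (p. 2 of the render), and the exponent is
  settled at the very end of the proof («On suitably adjusting the parameters `η` and `Q₁`,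
  [3, p. 21; 4, p. 287]», p. 28) from the exponents of `log X` in Lemma 4.1 (p. 19: «there is a
  constant `c`, depending at most on `f`»), Proposition 4.1 (p. 21) and Proposition 4.2 (ii)
  (p. 22: «with a suitable positive constant `c` depending at most on `f`»); the companion paper has
  the same wording ([4] = Heath-Brown–Moroz 2002, §5 Lemma 5.2 and §6 Proposition 6.1). Since `f`
  is the class polynomial `(a + dx₁)³ + 2(b + dx₂)³`, print gives ONE `c` PER CLASS — the
  `∀ (d, a, b) ∃ c` form vendored below. A form with one exponent for ALL classes
  (`∃ c ∀ (d, a, b)`) would need the Lemma 4.1 exponent bounded uniformly over the family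
  `f = f₀(γ⃗ + d x⃗)`, which is nowhere printed; it can be argued only from the notational convention
  «the letter `c` will be used to denote a positive absolute constant, though not necessarily the
  same at each occurrence» ([3] p. 6; [4] §1, Notation: «potentially different at each
  occurrence»), which the explicit «depending at most on `f`» of the lemmas overrides. An earlier
  revision of this file vendored that reading as a second named fact (`…_uniformExponent`); it is
  WITHDRAWN here as stronger than print (parity-ideate referee verdict g26 §2, 2026-08-27) — a
  consumer that wants a common exponent for finitely or infinitely many classes must carry it as
  its own hypothesis.
* `(log log X)^{−1/6}` is `Real.log (Real.log X) ^ (−1/6)`; the box is `(X, X(1+η)]²` for the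
  QUOTIENT coordinates `x⃗` (so `x = a + d x₁` runs over a box of side `dηX` at height `≈ dX`), and the
  denominator is `3 log X`, both exactly as printed in (1.2).
* `TODO(general form)`: the source treats every binary cubic form `f₀` irreducible over `ℤ`, every
  rank-2 module `F ⊂ 𝔬_k` and every `(γ, d)` (then `σ₁(f)` involves `Γ` at the primes dividing
  `C = i(θ)N(ω₁ω₂)d` and `ε(f) ∈ {1,2,3,6}` may exceed `1`); only `f₀ = x³ + 2y³` with admissible
  classes is vendored, in the vocabulary of `HeathBrownCubicPrimes`.

## Contents

* `residueClassPrimePairs X η d a b`, `residueClassPrimeCount` — the counted set and its cardinality;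
  `mem_residueClassPrimePairs_iff`; `residueClassPrimePairs_one_zero_zero` /
  `residueClassPrimeCount_one_zero_zero` — for `d = 1`, `a = b = 0` it is the tree's `primePairs` /
  `primePairCount`.
* `classWeightFactor p = p²(p+1)/((p²−1)(p+1−ν_p))`, `classWeight d = ∏_{p ∣ d} classWeightFactor p`;
  `classWeight_one`, `classWeightFactor_pos`, `classWeight_pos`, `classWeightFactor_mul`
  (`w(p)(p−1)(p+1−ν_p) = p²`).
* NAMED FACT `HeathBrownMoroz2004_residueClass` — Theorem 2 for `x³ + 2y³` and admissible classes
  (`∀ class ∃ c`, as printed; see «QUANTIFIER ORDER» above).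
* PROVED `HeathBrownMoroz2004_residueClass.isLittleO` — the `(1 + o(1))` form, class by class.
* PROVED `HeathBrownMoroz2004_residueClass.heathBrown2001` — its case `d = 1` is (literally) the
  tree's `HeathBrown2001_primePairCount_asymptotic` (which is a theorem of the tree,
  `HeathBrownCubicPrimesHolds`; the fact itself is the coset generalisation, whose printed proof is
  «as in [3, 4]» at every step — Type I §2, sieve §3, Type II §§4–5 of the source — and is NOT
  formalised here).
* (§2 of the source, appended) `residueClassDivPairs X η d a b q` / `residueClassDivCount` — the
  sifting counts `#𝒜_q` (pairs of the class whose value is divisible by `q`); `typeIDensity d q = Γ(q)`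
  (Lemma 2.4: `Γ(p) = ν_p/(p+1)` for `p ∤ d`, `Γ(p) = 0` for `p ∣ d` in an admissible class, extended
  multiplicatively over the prime factors); `zetaTwoCorrection d = ∏_{p ∣ d}(1 − p⁻²)⁻¹ = ζ(2)/ζ_d(2)`;
  NAMED FACT `HeathBrownMoroz2004_typeI_residueClass` — **Lemmas 2.3 + 2.4 (iii)**: the level of
  distribution `X^{3/2}` (in the quotient box of side `ηX`: `(Q + XQ^{1/2} + X^{3/2})(log QX)^{c(A)}`)
  of the coset sequence, `#𝒜_q = η²X²Γ(q)/ζ_d(2) + ρ₂(q, X)`, with divisor weights `τ(q)^A` — the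
  Type-I input of any upper-bound (Brun–Titchmarsh / Selberg) sieve for prime values of `x³ + 2y³` in
  a residue class.

## References

* D. R. Heath-Brown, B. Z. Moroz, *On the representation of primes by cubic polynomials in two
  variables*, Proc. London Math. Soc. (3) 88 (2004) 289–312: Theorem 2 ((1.2)), (1.1), (3.1),
  Lemma 2.4 and (2.35)–(2.36); §2: (2.3)–(2.4), Lemma 2.2, (2.26)–(2.28) Lemma 2.3, (2.29)
  Lemma 2.4 (iii); quantifier order: p. 2 (data fixed before Theorem 2), Lemma 4.1, Propositions
  4.1–4.2, and the closing adjustment of `η`, `Q₁` (§5, last paragraph).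
  [cite: HeathBrownMoroz2004, Theorem 2]
* D. R. Heath-Brown, B. Z. Moroz, *Primes represented by binary cubic forms*, Proc. London Math.
  Soc. (3) 84 (2002) 257–288: §1, Notation («`c` … a positive absolute … constant, potentially
  different at each occurrence»; `η := (log X)^{−c}` «defined as in [2]»), §5 Lemma 5.2 and §6
  Proposition 6.1 («a constant `c` depending at most on `f`») — cited for the convention only.
  [cite: HeathBrownMoroz2002, §1 Notation and Lemma 5.2]
* D. R. Heath-Brown, *Primes represented by `x³ + 2y³`*, Acta Math. 186 (2001) 1–84: Lemma 2.1 / 3.2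
  (the case `d = 1` of the Type-I bound, tree `CubicSieve.HeathBrown2001_typeI_A`) and (2.1) (the
  admissible range of `η`). [cite: HeathBrownActa2001, Lemma 2.1]
* D. R. Heath-Brown, *Primes represented by `x³ + 2y³`*, Acta Math. 186 (2001) 1–84: Theorem (p. 2),
  the case `d = 1`. [cite: HeathBrownActa2001, Theorem (p. 2)]

## Mathlib / tree search

`lean search 'HeathBrownMoroz|residueClassPrime|classWeight'`: nothing before this file. Used from the
tree: `primePairs`, `primePairCount`, `mem_primePairs_iff`, `cubeRootTwoCount` (+ `_two`,
`_le_three`), `singularProductPartial`, `mainTerm`, `HeathBrown2001_primePairCount_asymptotic`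
(`HeathBrownCubicPrimes`). Mathlib: `Nat.primeFactors`, `Finset.prod`, `Asymptotics.IsBigO`.
-/

noncomputable section

open Filter Asymptotics Finset Topology

namespace Literature.NumberTheory.Sieve.CubicPrimes

/-! ### The counted pairs -/

/-- The pairs `x⃗ = (x₁, x₂)` of natural numbers in the box `(X, X(1+η)]²` for which
`x = a + d x₁`, `y = b + d x₂` are coprime and `x³ + 2y³` is prime — the primes of
Heath-Brown–Moroz's sequence `𝒜` for `f(x⃗) = (a + dx₁)³ + 2(b + dx₂)³`, counted with the
multiplicity of their representations (the enclosing `Finset.Iic ⌊X(1+η)⌋₊²` only bounds the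
search, `mem_residueClassPrimePairs_iff`). [cite: HeathBrownMoroz2004, §1 (1.1)–(1.2) and §2] -/
def residueClassPrimePairs (X η : ℝ) (d a b : ℕ) : Finset (ℕ × ℕ) :=
  {uv ∈ Iic ⌊X * (1 + η)⌋₊ ×ˢ Iic ⌊X * (1 + η)⌋₊ |
      X < uv.1 ∧ (uv.1 : ℝ) ≤ X * (1 + η) ∧ X < uv.2 ∧ (uv.2 : ℝ) ≤ X * (1 + η) ∧
      Nat.Coprime (a + d * uv.1) (b + d * uv.2) ∧
      ((a + d * uv.1) ^ 3 + 2 * (b + d * uv.2) ^ 3).Prime}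

/-- `π(𝒜)` for the class `(a, b) mod d`: the number of pairs in `residueClassPrimePairs`.
[cite: HeathBrownMoroz2004, Theorem 2] -/
def residueClassPrimeCount (X η : ℝ) (d a b : ℕ) : ℕ :=
  #(residueClassPrimePairs X η d a b)

/-- Membership in `residueClassPrimePairs`: the bounding box is redundant.
[cite: HeathBrownMoroz2004, §1 (1.2)] -/
theorem mem_residueClassPrimePairs_iff {X η : ℝ} {d a b x₁ x₂ : ℕ} :
    (x₁, x₂) ∈ residueClassPrimePairs X η d a b ↔
      X < x₁ ∧ (x₁ : ℝ) ≤ X * (1 + η) ∧ X < x₂ ∧ (x₂ : ℝ) ≤ X * (1 + η) ∧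
        Nat.Coprime (a + d * x₁) (b + d * x₂) ∧
        ((a + d * x₁) ^ 3 + 2 * (b + d * x₂) ^ 3).Prime := by
  simp only [residueClassPrimePairs, mem_filter, mem_product, mem_Iic, and_iff_right_iff_imp]
  rintro ⟨-, hx, -, hy, -, -⟩
  exact ⟨Nat.le_floor hx, Nat.le_floor hy⟩

/-- `residueClassPrimeCount` unfolded. [cite: HeathBrownMoroz2004, Theorem 2] -/
theorem residueClassPrimeCount_def (X η : ℝ) (d a b : ℕ) :
    residueClassPrimeCount X η d a b = #(residueClassPrimePairs X η d a b) := rfl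

/-- For the trivial class (`d = 1`, `a = b = 0`) the counted pairs are exactly Heath-Brown's
`primePairs` (`x = x₁`, `y = x₂`). [cite: HeathBrownActa2001, §2 (2.2)] -/
theorem residueClassPrimePairs_one_zero_zero (X η : ℝ) :
    residueClassPrimePairs X η 1 0 0 = primePairs X η := by
  ext ⟨x, y⟩
  rw [mem_residueClassPrimePairs_iff, mem_primePairs_iff]
  simp only [zero_add, one_mul]

/-- For the trivial class the count is Heath-Brown's `π(𝒜) = primePairCount`.
[cite: HeathBrownActa2001, §2 (2.2)] -/
theorem residueClassPrimeCount_one_zero_zero (X η : ℝ) :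
    residueClassPrimeCount X η 1 0 0 = primePairCount X η := by
  rw [residueClassPrimeCount_def, residueClassPrimePairs_one_zero_zero, primePairCount_def]

/-! ### The local correction `w(d)` of the singular series -/

/-- The local factor at a prime `p ∣ d` of an admissible class:
`w(p) = p²(p + 1)/((p² − 1)(p + 1 − ν_p))` — the ratio `σ₁(f)/σ₀` contributed by `p`, namely
`(1 − Γ_{f₀}(p))⁻¹ = (p+1)/(p+1−ν_p)` (Lemma 2.4 (iv), `Γ_f(p) = 0` for `p ∣ d`) times
`(1 − p⁻²)⁻¹` ((3.1)). [cite: HeathBrownMoroz2004, (3.1) and Lemma 2.4] -/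
def classWeightFactor (p : ℕ) : ℝ :=
  (p : ℝ) ^ 2 * ((p : ℝ) + 1) / (((p : ℝ) ^ 2 - 1) * ((p : ℝ) + 1 - cubeRootTwoCount p))

/-- `classWeightFactor` unfolded. [cite: HeathBrownMoroz2004, (3.1) and Lemma 2.4] -/
theorem classWeightFactor_def (p : ℕ) :
    classWeightFactor p =
      (p : ℝ) ^ 2 * ((p : ℝ) + 1) / (((p : ℝ) ^ 2 - 1) * ((p : ℝ) + 1 - cubeRootTwoCount p)) := rfl

/-- `w(d) = ∏_{p ∣ d} w(p)`: the quotient `σ₁(f)/σ₀` of Heath-Brown–Moroz's singular series for an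
admissible class modulo `d` by Heath-Brown's `σ₀` (module docstring). [cite: HeathBrownMoroz2004, (3.1) and Lemma 2.4] -/
def classWeight (d : ℕ) : ℝ :=
  ∏ p ∈ d.primeFactors, classWeightFactor p

/-- `classWeight` unfolded. [cite: HeathBrownMoroz2004, (3.1)] -/
theorem classWeight_def (d : ℕ) : classWeight d = ∏ p ∈ d.primeFactors, classWeightFactor p := rfl

/-- `w(1) = 1` (no local correction for the trivial modulus: `σ₁(f₀) = σ(f₀) = σ₀`).
[cite: HeathBrownMoroz2004, (3.1)] -/
theorem classWeight_one : classWeight 1 = 1 := by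
  simp [classWeight, Nat.primeFactors_one]

/-- For a prime `p`, `p + 1 − ν_p > 0` (`ν₂ = 1`; `ν_p ≤ 3 < p + 1` for `p ≥ 3`) — the factor
`1 − Γ(p) = (p + 1 − ν_p)/(p + 1)` of `σ(f)` is positive (Lemma 2.4 (ii), (iv)).
[cite: HeathBrownMoroz2004, Lemma 2.4] -/
theorem cast_add_one_sub_cubeRootTwoCount_pos {p : ℕ} (hp : p.Prime) :
    0 < (p : ℝ) + 1 - cubeRootTwoCount p := by
  by_cases h2 : p = 2
  · subst h2; rw [cubeRootTwoCount_two]; norm_num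
  · have h3 : (cubeRootTwoCount p : ℝ) ≤ 3 := by exact_mod_cast cubeRootTwoCount_le_three hp
    have hp3 : (3 : ℝ) ≤ p := by
      have h3' : 3 ≤ p := by have := hp.two_le; omega
      exact_mod_cast h3'
    linarith

/-- Each local factor is positive (so `σ₁(f) = σ₀ · w(d) > 0`, as asserted in Theorem 2).
[cite: HeathBrownMoroz2004, Theorem 2 and (3.1)] -/
theorem classWeightFactor_pos {p : ℕ} (hp : p.Prime) : 0 < classWeightFactor p := by
  have hp2 : (2 : ℝ) ≤ p := by exact_mod_cast hp.two_le
  have h1 : 0 < (p : ℝ) ^ 2 - 1 := by nlinarith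
  have h2 := cast_add_one_sub_cubeRootTwoCount_pos hp
  unfold classWeightFactor
  positivity

/-- `w(d) > 0` (so `σ₁(f) = σ₀ · w(d) > 0`, as asserted in Theorem 2).
[cite: HeathBrownMoroz2004, Theorem 2 and (3.1)] -/
theorem classWeight_pos (d : ℕ) : 0 < classWeight d :=
  prod_pos fun _ hp => classWeightFactor_pos (Nat.prime_of_mem_primeFactors hp)

/-- The consistency identity `w(p) · (p − 1)(p + 1 − ν_p) = p²` for a prime `p`: the per-class main
term times the number `(p − 1)(p + 1 − ν_p)` of admissible classes modulo `p` is `p²` times the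
per-class main term with `w = 1`, i.e. the classes modulo `p` exhaust Heath-Brown's count at height
`pX`. [cite: HeathBrownMoroz2004, (3.1) and Lemma 2.4] -/
theorem classWeightFactor_mul {p : ℕ} (hp : p.Prime) :
    classWeightFactor p * (((p : ℝ) - 1) * ((p : ℝ) + 1 - cubeRootTwoCount p)) = (p : ℝ) ^ 2 := by
  have hp2 : (2 : ℝ) ≤ p := by exact_mod_cast hp.two_le
  have h1 : (p : ℝ) ^ 2 - 1 ≠ 0 := by nlinarith
  have h2 : (p : ℝ) + 1 - cubeRootTwoCount p ≠ 0 := (cast_add_one_sub_cubeRootTwoCount_pos hp).ne'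
  unfold classWeightFactor
  field_simp
  ring

/-! ### The named fact -/

/-- **Heath-Brown–Moroz 2004, Theorem 2, for `x³ + 2y³` and an admissible class.** For every modulus
`d ≥ 1` and all `a, b ∈ ℕ` with `gcd(a³ + 2b³, d) = 1` there is a positive constant `c` such that,
with `η = η(X) = (log X)^{−c}` and `σ₀ > 0` the limit of the ordered partial products of
Heath-Brown's singular product `∏_p (1 − (ν_p − 1)/p)`, the number of pairs of natural numbers
`X < x₁, x₂ ≤ X(1+η)` with `(a + dx₁, b + dx₂) = 1` and `(a + dx₁)³ + 2(b + dx₂)³` prime equals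
`σ₀ · w(d) · η²X²/(3 log X) · {1 + O((log log X)^{−1/6})}` as `X → ∞`, where
`w(d) = ∏_{p ∣ d} p²(p+1)/((p²−1)(p+1−ν_p))` (`classWeight`; `= σ₁(f)/σ₀` by (3.1) and Lemma 2.4,
module docstring). This is (1.2) with `f(x⃗) = N_{k/ℚ}(γ + dx)N𝔡⁻¹ = (a + dx₁)³ + 2(b + dx₂)³`
(`k = ℚ(2^{1/3})`, `F = ℤ + ℤ·2^{1/3}`, `γ = a + b·2^{1/3}`, `𝔡 = 𝔬`, `ε(f) = 1`).
[cite: HeathBrownMoroz2004, Theorem 2] -/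
def HeathBrownMoroz2004_residueClass : Prop :=
  ∀ d a b : ℕ, 0 < d → Nat.Coprime (a ^ 3 + 2 * b ^ 3) d →
    ∃ c : ℝ, 0 < c ∧ ∃ σ₀ : ℝ, 0 < σ₀ ∧ Tendsto singularProductPartial atTop (𝓝 σ₀) ∧
      (fun X : ℝ => (residueClassPrimeCount X (Real.log X ^ (-c)) d a b : ℝ) -
          classWeight d * mainTerm c σ₀ X) =O[atTop]
        fun X : ℝ => mainTerm c σ₀ X * Real.log (Real.log X) ^ (-(1 / 6 : ℝ))

/-- The error factor of Theorem 2 tends to zero: `(log log X)^{−1/6} → 0` as `X → ∞`, hence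
`mainTerm c σ₀ X · (log log X)^{−1/6} = o(mainTerm c σ₀ X)` — the step from the printed
`{1 + O((log log X)^{−1/6})}` to `(1 + o(1))`. [cite: HeathBrownMoroz2004, Theorem 2 (1.2)] -/
theorem mainTerm_mul_loglog_isLittleO (c σ₀ : ℝ) :
    (fun X : ℝ => mainTerm c σ₀ X * Real.log (Real.log X) ^ (-(1 / 6 : ℝ))) =o[atTop]
      fun X : ℝ => mainTerm c σ₀ X := by
  have hll : Tendsto (fun X : ℝ => Real.log (Real.log X) ^ (-(1 / 6 : ℝ))) atTop (𝓝 0) :=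
    (tendsto_rpow_neg_atTop (by norm_num : (0 : ℝ) < 1 / 6)).comp
      (Real.tendsto_log_atTop.comp Real.tendsto_log_atTop)
  have h2 := (Asymptotics.isBigO_refl (fun X : ℝ => mainTerm c σ₀ X) atTop).mul_isLittleO
    ((Asymptotics.isLittleO_one_iff ℝ).2 hll)
  simpa only [mul_one] using h2

/-- **Corollary: the `(1 + o(1))` form of Theorem 2, class by class** — for every admissible class
`(a, b) mod d` there are `c > 0` (the class's own box exponent, as printed) and Heath-Brown's `σ₀`
with `π(class box) − classWeight d · mainTerm c σ₀ X = o(mainTerm c σ₀ X)`.  (One exponent `c`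
serving several classes at once is NOT asserted by the source — see «QUANTIFIER ORDER» in the
module docstring — and is not derivable from this fact, monotonicity of the count in `c` not being
formal; a consumer needing it carries it as a hypothesis.)
[cite: HeathBrownMoroz2004, Theorem 2 (1.2)] -/
theorem HeathBrownMoroz2004_residueClass.isLittleO (h : HeathBrownMoroz2004_residueClass) :
    ∀ d a b : ℕ, 0 < d → Nat.Coprime (a ^ 3 + 2 * b ^ 3) d →
      ∃ c : ℝ, 0 < c ∧ ∃ σ₀ : ℝ, 0 < σ₀ ∧ Tendsto singularProductPartial atTop (𝓝 σ₀) ∧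
        (fun X : ℝ => (residueClassPrimeCount X (Real.log X ^ (-c)) d a b : ℝ) -
            classWeight d * mainTerm c σ₀ X) =o[atTop] fun X : ℝ => mainTerm c σ₀ X := by
  intro d a b hd hab
  obtain ⟨c, hc, σ₀, hσ₀, hlim, hO⟩ := h d a b hd hab
  exact ⟨c, hc, σ₀, hσ₀, hlim, hO.trans_isLittleO (mainTerm_mul_loglog_isLittleO c σ₀)⟩

/-- The case `d = 1`, `a = b = 0` of Heath-Brown–Moroz's Theorem 2 is Heath-Brown's 2001 theorem in the
form (2.2) — the tree's `HeathBrown2001_primePairCount_asymptotic` (a theorem of the tree,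
`HeathBrownCubicPrimesHolds`); recorded to pin the normalisations (`w(1) = 1`, same box, same
main term). [cite: HeathBrownMoroz2004, Theorem 2; HeathBrownActa2001, Theorem (p. 2)] -/
theorem HeathBrownMoroz2004_residueClass.heathBrown2001 (h : HeathBrownMoroz2004_residueClass) :
    HeathBrown2001_primePairCount_asymptotic := by
  obtain ⟨c, hc, σ₀, hσ₀, hlim, hO⟩ := h 1 0 0 one_pos (Nat.coprime_one_right _)
  refine ⟨c, hc, σ₀, hσ₀, hlim, ?_⟩
  simpa only [residueClassPrimeCount_one_zero_zero, classWeight_one, one_mul] using hO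

/-! ### §2 of the source: the Type-I level of distribution of the coset sequence (Lemmas 2.3, 2.4) -/

/-- The pairs `x⃗` of the class-box (as in `residueClassPrimePairs`: `X < x₁, x₂ ≤ X(1+η)`,
`(a + dx₁, b + dx₂) = 1`) whose value `(a + dx₁)³ + 2(b + dx₂)³` is divisible by `q` — the elements
of Heath-Brown–Moroz's `𝒜_q = {c ∈ 𝒜 : q ∣ c}` (§1: "Given a sequence `D` of rational integers … let
`D_a = {c : c ∈ D, a | c}`"), counted with multiplicity. [cite: HeathBrownMoroz2004, §2 (2.4)] -/
def residueClassDivPairs (X η : ℝ) (d a b q : ℕ) : Finset (ℕ × ℕ) :=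
  {uv ∈ Iic ⌊X * (1 + η)⌋₊ ×ˢ Iic ⌊X * (1 + η)⌋₊ |
      X < uv.1 ∧ (uv.1 : ℝ) ≤ X * (1 + η) ∧ X < uv.2 ∧ (uv.2 : ℝ) ≤ X * (1 + η) ∧
      Nat.Coprime (a + d * uv.1) (b + d * uv.2) ∧
      q ∣ (a + d * uv.1) ^ 3 + 2 * (b + d * uv.2) ^ 3}

/-- `#𝒜_q` for the class `(a, b) mod d`. [cite: HeathBrownMoroz2004, §2 (2.4)] -/
def residueClassDivCount (X η : ℝ) (d a b q : ℕ) : ℕ :=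
  #(residueClassDivPairs X η d a b q)

/-- Membership in `residueClassDivPairs`: the bounding box is redundant.
[cite: HeathBrownMoroz2004, §2 (2.4)] -/
theorem mem_residueClassDivPairs_iff {X η : ℝ} {d a b q x₁ x₂ : ℕ} :
    (x₁, x₂) ∈ residueClassDivPairs X η d a b q ↔
      X < x₁ ∧ (x₁ : ℝ) ≤ X * (1 + η) ∧ X < x₂ ∧ (x₂ : ℝ) ≤ X * (1 + η) ∧
        Nat.Coprime (a + d * x₁) (b + d * x₂) ∧
        q ∣ (a + d * x₁) ^ 3 + 2 * (b + d * x₂) ^ 3 := by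
  simp only [residueClassDivPairs, mem_filter, mem_product, mem_Iic, and_iff_right_iff_imp]
  rintro ⟨-, hx, -, hy, -, -⟩
  exact ⟨Nat.le_floor hx, Nat.le_floor hy⟩

/-- `residueClassDivCount` unfolded. [cite: HeathBrownMoroz2004, §2 (2.4)] -/
theorem residueClassDivCount_def (X η : ℝ) (d a b q : ℕ) :
    residueClassDivCount X η d a b q = #(residueClassDivPairs X η d a b q) := rfl

/-- `𝒜_1 = 𝒜`: for `q = 1` the divisibility condition is void and `residueClassDivPairs` is the set of
all coprime pairs of the class-box. [cite: HeathBrownMoroz2004, §2 (2.4)] -/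
theorem mem_residueClassDivPairs_one_iff {X η : ℝ} {d a b x₁ x₂ : ℕ} :
    (x₁, x₂) ∈ residueClassDivPairs X η d a b 1 ↔
      X < x₁ ∧ (x₁ : ℝ) ≤ X * (1 + η) ∧ X < x₂ ∧ (x₂ : ℝ) ≤ X * (1 + η) ∧
        Nat.Coprime (a + d * x₁) (b + d * x₂) := by
  rw [mem_residueClassDivPairs_iff]
  simp only [one_dvd, and_true]

/-- The primes of the class are among `𝒜`: `residueClassPrimePairs ⊆ residueClassDivPairs … 1`.
[cite: HeathBrownMoroz2004, §2] -/
theorem residueClassPrimePairs_subset_residueClassDivPairs_one (X η : ℝ) (d a b : ℕ) :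
    residueClassPrimePairs X η d a b ⊆ residueClassDivPairs X η d a b 1 := by
  rintro ⟨x₁, x₂⟩ h
  obtain ⟨h1, h2, h3, h4, h5, -⟩ := mem_residueClassPrimePairs_iff.1 h
  exact mem_residueClassDivPairs_one_iff.2 ⟨h1, h2, h3, h4, h5⟩

/-- Heath-Brown–Moroz's multiplicative density `Γ(q)` of Lemma 2.4 for `f₀ = x³ + 2y³` and an
ADMISSIBLE class modulo `d`, on square-free `q` (the only `q` the source uses): the product over the
prime factors `p` of `q` of `Γ(p) = ν_p/(p + 1)` if `p ∤ d` (Lemma 2.4 (iv) — for this `f₀` also at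
`p = 2`, see the module docstring) and `Γ(p) = 0` if `p ∣ d` ((2.36): in an admissible class no value
is divisible by `p`). [cite: HeathBrownMoroz2004, Lemma 2.4] -/
def typeIDensity (d q : ℕ) : ℝ :=
  ∏ p ∈ q.primeFactors, if p ∣ d then 0 else (cubeRootTwoCount p : ℝ) / ((p : ℝ) + 1)

/-- `typeIDensity` unfolded. [cite: HeathBrownMoroz2004, Lemma 2.4] -/
theorem typeIDensity_def (d q : ℕ) :
    typeIDensity d q =
      ∏ p ∈ q.primeFactors, if p ∣ d then 0 else (cubeRootTwoCount p : ℝ) / ((p : ℝ) + 1) := rfl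

/-- `Γ(1) = 1`. [cite: HeathBrownMoroz2004, Lemma 2.4] -/
theorem typeIDensity_one (d : ℕ) : typeIDensity d 1 = 1 := by
  simp [typeIDensity, Nat.primeFactors_one]

/-- `Γ(p)` at a prime: `ν_p/(p+1)` off `d`, `0` on `d`. [cite: HeathBrownMoroz2004, Lemma 2.4] -/
theorem typeIDensity_prime (d : ℕ) {p : ℕ} (hp : p.Prime) :
    typeIDensity d p = if p ∣ d then 0 else (cubeRootTwoCount p : ℝ) / ((p : ℝ) + 1) := by
  rw [typeIDensity, hp.primeFactors, Finset.prod_singleton]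

/-- `0 ≤ Γ(q) ≤ 1` termwise: each factor lies in `[0, 1]` (Lemma 2.4 (i); `ν_p ≤ 3 ≤ p + 1` and
`ν₂ = 1`). [cite: HeathBrownMoroz2004, Lemma 2.4] -/
theorem typeIDensity_nonneg (d q : ℕ) : 0 ≤ typeIDensity d q :=
  Finset.prod_nonneg fun p _ => by
    split_ifs
    · exact le_rfl
    · positivity

/-- The coprimality correction `ζ(2)/ζ_d(2) = ∏_{p ∣ d} (1 − p⁻²)⁻¹` of (2.29)/(3.1) (the density of
pairs with `(a + dx₁, b + dx₂) = 1` is `∏_{p ∤ d}(1 − p⁻²) = ζ_d(2)⁻¹`, the primes `p ∣ d` never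
dividing both coordinates in a class with `(γ₁, γ₂, d) = 1`). [cite: HeathBrownMoroz2004, Lemma 2.4] -/
def zetaTwoCorrection (d : ℕ) : ℝ :=
  ∏ p ∈ d.primeFactors, (1 - ((p : ℝ) ^ 2)⁻¹)⁻¹

/-- `zetaTwoCorrection` unfolded. [cite: HeathBrownMoroz2004, Lemma 2.4] -/
theorem zetaTwoCorrection_def (d : ℕ) :
    zetaTwoCorrection d = ∏ p ∈ d.primeFactors, (1 - ((p : ℝ) ^ 2)⁻¹)⁻¹ := rfl

/-- `ζ(2)/ζ_1(2) = 1`. [cite: HeathBrownMoroz2004, Lemma 2.4] -/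
theorem zetaTwoCorrection_one : zetaTwoCorrection 1 = 1 := by
  simp [zetaTwoCorrection, Nat.primeFactors_one]

/-- `ζ(2)/ζ_d(2) > 0`. [cite: HeathBrownMoroz2004, Lemma 2.4] -/
theorem zetaTwoCorrection_pos (d : ℕ) : 0 < zetaTwoCorrection d :=
  Finset.prod_pos fun p hp => by
    have hp2 : (2 : ℝ) ≤ p := by exact_mod_cast (Nat.prime_of_mem_primeFactors hp).two_le
    have h4 : (4 : ℝ) ≤ (p : ℝ) ^ 2 := by nlinarith
    have : ((p : ℝ) ^ 2)⁻¹ ≤ 4⁻¹ := by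
      exact inv_anti₀ (by norm_num) h4
    have h1 : 0 < 1 - ((p : ℝ) ^ 2)⁻¹ := by linarith [show (4:ℝ)⁻¹ < 1 by norm_num]
    positivity

/-- The printed Type-I main term `[𝒜_q] = η²X²Γ(q)/ζ_d(2)` ((2.29)), written as
`(6/π²)·η²X²·(ζ(2)/ζ_d(2))·Γ(q)` with `1/ζ(2) = 6/π²`. [cite: HeathBrownMoroz2004, Lemma 2.4] -/
def typeIMainTerm (X η : ℝ) (d q : ℕ) : ℝ :=
  6 * η ^ 2 * X ^ 2 / Real.pi ^ 2 * zetaTwoCorrection d * typeIDensity d q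

/-- `typeIMainTerm` unfolded. [cite: HeathBrownMoroz2004, Lemma 2.4] -/
theorem typeIMainTerm_def (X η : ℝ) (d q : ℕ) :
    typeIMainTerm X η d q = 6 * η ^ 2 * X ^ 2 / Real.pi ^ 2 * zetaTwoCorrection d * typeIDensity d q :=
  rfl

open scoped Classical in
/-- **Heath-Brown–Moroz 2004, Lemma 2.3 with Lemma 2.4 (iii), for `x³ + 2y³` and an admissible class**
— the Type-I estimate (level of distribution of the coset sequence): «If `μ(q)² = 1`, then
`#𝒜_q = [𝒜_q] + ρ₂(q, X)`; moreover, for any positive integer `A`, there is a constant `c(A)` such that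
`∑_{Q < q ≤ 2Q} τ(q)^A μ(q)² |ρ₂(q, X)| ≪ (Q + XQ^{1/2} + X^{3/2})(log QX)^{c(A)}`» ((2.27)–(2.28)), with
`[𝒜_q] = η²X²Γ(q)/ζ_d(2)` ((2.29)).  Here `𝒜 = {(a+dx₁)³ + 2(b+dx₂)³ : X < x₁, x₂ ≤ X(1+η),
((a+dx₁),(b+dx₂)) = 1}` for a modulus `d ≥ 1` and a class `(a, b)` with `gcd(a³+2b³, d) = 1`, `Γ` is
`typeIDensity d` and `ζ(2)/ζ_d(2)` is `zetaTwoCorrection d` (module docstring); the implied constant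
and the exponent may depend on `d, a, b` and `A` (the source's "depending on `f`"; by §2 the true
dependence on `d` is polynomial — `m(R, γ) ≤ c·rad(d)` — but this is not asserted here), and `η`
ranges over Heath-Brown's admissible range (2.1) of [3], `exp(−(log X)^{1/3}) ≤ η ≤ 1`, under which
the case `d = 1` ([3, Lemma 2.1], the tree's `CubicSieve.HeathBrown2001_typeI_A`) is printed and which
§2 of the source follows «as in [3, pp. 28–33; 4, pp. 261–265]» (the side `ηX` of the box `I(X)` is
the only place `η` enters (2.10)).  This is the Type-I input of every upper-bound sieve for prime
values of `x³ + 2y³` in a residue class (Brun–Titchmarsh / Selberg `Λ²`), and, through Lemmata 3.1–3.3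
of the source, of Theorem 2 itself. [cite: HeathBrownMoroz2004, Lemma 2.3] -/
def HeathBrownMoroz2004_typeI_residueClass : Prop :=
  ∀ d a b : ℕ, 0 < d → Nat.Coprime (a ^ 3 + 2 * b ^ 3) d → ∀ A : ℕ, 0 < A → ∃ c C : ℝ,
    ∀ X η Q : ℝ, 2 ≤ X → Real.exp (-Real.log X ^ (1 / 3 : ℝ)) ≤ η → η ≤ 1 → 1 ≤ Q →
      ∑ q ∈ (Iic ⌊2 * Q⌋₊).filter (fun q : ℕ => Q < (q : ℝ) ∧ (q : ℝ) ≤ 2 * Q ∧ Squarefree q),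
        ((Nat.divisors q).card : ℝ) ^ A *
          |(residueClassDivCount X η d a b q : ℝ) - typeIMainTerm X η d q| ≤
      C * (Q + X * Real.sqrt Q + X ^ (3 / 2 : ℝ)) * Real.log (Q * X) ^ c

end Literature.NumberTheory.Sieve.CubicPrimes

end
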